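import Mathlib.Analysis.SpecialFunctions.SmoothTransition
import Mathlib.Analysis.SpecialFunctions.Trigonometric.Bounds
import Mathlib.Analysis.SpecialFunctions.Trigonometric.Deriv
import Mathlib.MeasureTheory.Integral.IntervalIntegral.FundThmCalculus
import Literature.Analysis.Calculus.SmoothCutoff
import HarnessLib

/-!
# Sheet-dodger profile: a smooth odd square wave (negative knowledge for the Lamb-floor machinery of crux
# stmt-AnomalousDissipation-13038, line `lamb-floor-f123-shared-ceiling`)

The 1-D ingredient of the explicit Onsager dodgers for Kolmogorov-mode forces: `σ y = ρ(y + ½) − ρ(½ − y)`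
(`ρ = Real.smoothTransition`) and `P_n(t) = σ(n sin 2πt)`: `1`-periodic, odd under the half-period shift, `|P_n| ≤ 1`,
`= ±1` off layers of total length `≤ 1/(2n)` (Jordan), `∫₀¹(1 − P_n²) ≤ 1/(2n)`, `8n ≤ ∫₀¹ P_n'² ≤ 2π²D²n`. Pure proofs, no definitions.
-/

noncomputable section

open Set Filter MeasureTheory intervalIntegral
open scoped Topology Real ContDiff

-- `Summit.<Summit>.<Problem>` is the tree's mandated summit-side namespace (CONVENTIONS §2); single-conjunct summit, duplicate deliberate.
set_option linter.dupNamespace false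

namespace Summit.AnomalousDissipation.AnomalousDissipation.Theorems.SteadyStatesLoudBounded.SheetDodger

open Literature.Analysis.Calculus


/-- `σ` is smooth. -/
theorem contDiff_sgn : ContDiff ℝ ∞
    (fun y : ℝ => Real.smoothTransition (y + 2⁻¹) - Real.smoothTransition (2⁻¹ - y)) :=
  (Real.smoothTransition.contDiff.comp (contDiff_id.add contDiff_const)).sub
    (Real.smoothTransition.contDiff.comp (contDiff_const.sub contDiff_id))

/-- `σ` is odd. -/
theorem sgn_neg (y : ℝ) :
    Real.smoothTransition (-y + 2⁻¹) - Real.smoothTransition (2⁻¹ - -y) =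
      -(Real.smoothTransition (y + 2⁻¹) - Real.smoothTransition (2⁻¹ - y)) := by
  rw [show -y + 2⁻¹ = 2⁻¹ - y by ring, show (2⁻¹ : ℝ) - -y = y + 2⁻¹ by ring]
  ring

/-- `σ y = 1` for `y ≥ ½`. -/
theorem sgn_of_half_le {y : ℝ} (hy : 2⁻¹ ≤ y) :
    Real.smoothTransition (y + 2⁻¹) - Real.smoothTransition (2⁻¹ - y) = 1 := by
  rw [Real.smoothTransition.one_of_one_le (by linarith), Real.smoothTransition.zero_of_nonpos (by linarith)]
  ring

/-- `σ y = -1` for `y ≤ -½`. -/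
theorem sgn_of_le_neg_half {y : ℝ} (hy : y ≤ -2⁻¹) :
    Real.smoothTransition (y + 2⁻¹) - Real.smoothTransition (2⁻¹ - y) = -1 := by
  rw [Real.smoothTransition.zero_of_nonpos (by linarith), Real.smoothTransition.one_of_one_le (by linarith)]
  ring

/-- `|σ y| ≤ 1`. -/
theorem abs_sgn_le (y : ℝ) :
    |Real.smoothTransition (y + 2⁻¹) - Real.smoothTransition (2⁻¹ - y)| ≤ 1 := by
  rw [abs_le]
  have h1 := Real.smoothTransition.nonneg (y + 2⁻¹)
  have h2 := Real.smoothTransition.le_one (y + 2⁻¹)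
  have h3 := Real.smoothTransition.nonneg (2⁻¹ - y)
  have h4 := Real.smoothTransition.le_one (2⁻¹ - y)
  constructor <;> linarith

/-- The derivative of `σ`. -/
theorem hasDerivAt_sgn (y : ℝ) :
    HasDerivAt (fun y : ℝ => Real.smoothTransition (y + 2⁻¹) - Real.smoothTransition (2⁻¹ - y))
      (deriv Real.smoothTransition (y + 2⁻¹) + deriv Real.smoothTransition (2⁻¹ - y)) y := by
  have hd : ∀ z, HasDerivAt Real.smoothTransition (deriv Real.smoothTransition z) z :=
    fun z => (differentiable_smoothTransition z).hasDerivAt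
  have h1 : HasDerivAt (fun y : ℝ => Real.smoothTransition (y + 2⁻¹)) (deriv Real.smoothTransition (y + 2⁻¹)) y := by
    have h := (hd (y + 2⁻¹)).comp y ((hasDerivAt_id y).add_const (2⁻¹ : ℝ))
    simpa [Function.comp_def] using h
  have h2 : HasDerivAt (fun y : ℝ => Real.smoothTransition (2⁻¹ - y)) (-deriv Real.smoothTransition (2⁻¹ - y)) y := by
    have h := (hd (2⁻¹ - y)).comp y ((hasDerivAt_const y (2⁻¹ : ℝ)).sub (hasDerivAt_id y))
    simpa [Function.comp_def] using h
  exact (h1.sub h2).congr_deriv (by ring)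

/-- The derivative of `σ` vanishes for `|y| ≥ ½`. -/
theorem deriv_sgn_eq_zero {y : ℝ} (hy : 2⁻¹ ≤ |y|) :
    deriv Real.smoothTransition (y + 2⁻¹) + deriv Real.smoothTransition (2⁻¹ - y) = 0 := by
  rcases le_abs'.1 hy with h | h
  · rw [deriv_smoothTransition_of_nonpos (by linarith), deriv_smoothTransition_of_one_le (by linarith), add_zero]
  · rw [deriv_smoothTransition_of_one_le (by linarith), deriv_smoothTransition_of_nonpos (by linarith), add_zero]

/-- A uniform bound for the derivative of `σ`: `|σ'| ≤ 2D` with `D` the bound of `ρ'`. -/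
theorem exists_bound_deriv_sgn : ∃ D : ℝ, 0 ≤ D ∧ ∀ y : ℝ,
    |deriv Real.smoothTransition (y + 2⁻¹) + deriv Real.smoothTransition (2⁻¹ - y)| ≤ D := by
  obtain ⟨D, hD0, hD⟩ := exists_bound_deriv_smoothTransition
  refine ⟨2 * D, by positivity, fun y => ?_⟩
  calc |deriv Real.smoothTransition (y + 2⁻¹) + deriv Real.smoothTransition (2⁻¹ - y)|
      ≤ |deriv Real.smoothTransition (y + 2⁻¹)| + |deriv Real.smoothTransition (2⁻¹ - y)| := abs_add_le _ _
    _ ≤ D + D := add_le_add (hD _) (hD _)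
    _ = 2 * D := by ring


/-- On `[0, ¼]`: `4t ≤ sin(2πt)`. -/
theorem four_mul_le_sin {t : ℝ} (h0 : 0 ≤ t) (h1 : t ≤ 4⁻¹) : 4 * t ≤ Real.sin (2 * π * t) := by
  have h := Real.mul_le_sin (x := 2 * π * t) (by positivity) (by nlinarith [Real.pi_pos])
  have e : 2 / π * (2 * π * t) = 4 * t := by field_simp; ring
  linarith [e]

/-- If `|sin(2πt)| < 4a` and `t ∈ [0,1]`, then `t` is within `a` of `0`, `½` or `1`. -/
theorem near_zeros_of_abs_sin_lt {t a : ℝ} (h0 : 0 ≤ t) (h1 : t ≤ 1)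
    (hs : |Real.sin (2 * π * t)| < 4 * a) :
    t < a ∨ (2⁻¹ - a < t ∧ t < 2⁻¹ + a) ∨ 1 - a < t := by
  by_contra hcon
  push Not at hcon
  obtain ⟨hta, hmid, ht1⟩ := hcon
  rcases le_or_gt t 4⁻¹ with hq1 | hq1
  · have h := four_mul_le_sin h0 hq1
    have : 4 * a ≤ Real.sin (2 * π * t) := by linarith
    exact absurd hs (not_lt.2 (this.trans (le_abs_self _)))
  rcases le_or_gt t 2⁻¹ with hq2 | hq2
  · -- `sin(2πt) = sin(2π(½ - t))`, `½ - t ∈ [0, ¼]`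
    have e : Real.sin (2 * π * t) = Real.sin (2 * π * (2⁻¹ - t)) := by
      rw [show 2 * π * (2⁻¹ - t) = π - 2 * π * t by ring, Real.sin_pi_sub]
    have h := four_mul_le_sin (t := 2⁻¹ - t) (by linarith) (by linarith)
    have hm : a ≤ 2⁻¹ - t := by
      by_contra hlt
      push Not at hlt
      exact absurd hq2 (not_le.2 (by linarith [hmid (by linarith)]))
    have : 4 * a ≤ Real.sin (2 * π * t) := by rw [e]; linarith
    exact absurd hs (not_lt.2 (this.trans (le_abs_self _)))
  rcases le_or_gt t (3 / 4) with hq3 | hq3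
  · -- `sin(2πt) = -sin(2π(t - ½))`, `t - ½ ∈ [0, ¼]`
    have e : Real.sin (2 * π * t) = -Real.sin (2 * π * (t - 2⁻¹)) := by
      rw [show 2 * π * (t - 2⁻¹) = 2 * π * t - π by ring, Real.sin_sub_pi, neg_neg]
    have h := four_mul_le_sin (t := t - 2⁻¹) (by linarith) (by linarith)
    have hm : a ≤ t - 2⁻¹ := by
      by_contra hlt
      push Not at hlt
      linarith [hmid (by linarith)]
    have : 4 * a ≤ -Real.sin (2 * π * t) := by rw [e, neg_neg]; linarith
    exact absurd hs (not_lt.2 (this.trans (neg_le_abs _)))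
  · -- `sin(2πt) = -sin(2π(1 - t))`, `1 - t ∈ [0, ¼]`
    have e : Real.sin (2 * π * t) = -Real.sin (2 * π * (1 - t)) := by
      rw [show 2 * π * (1 - t) = 2 * π - 2 * π * t by ring, Real.sin_two_pi_sub, neg_neg]
    have h := four_mul_le_sin (t := 1 - t) (by linarith) (by linarith)
    have : 4 * a ≤ -Real.sin (2 * π * t) := by rw [e, neg_neg]; linarith
    exact absurd hs (not_lt.2 (this.trans (neg_le_abs _)))


/-- Contrapositive form: at points of `[0,1]` away from `0, ½, 1` by at least `a`, `|sin 2πt| ≥ 4a`. -/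
theorem le_abs_sin_of_far {t a : ℝ} (h0 : 0 ≤ t) (h1 : t ≤ 1) (hta : a ≤ t)
    (hmid : t ≤ 2⁻¹ - a ∨ 2⁻¹ + a ≤ t) (ht1 : t ≤ 1 - a) : 4 * a ≤ |Real.sin (2 * π * t)| := by
  by_contra hlt
  push Not at hlt
  rcases near_zeros_of_abs_sin_lt h0 h1 hlt with h | ⟨h2, h3⟩ | h
  · linarith
  · rcases hmid with h4 | h4 <;> linarith
  · linarith


/-- **Layer bound**: `g` continuous, `g ≤ M`, vanishing on `[0,1]` where `|sin 2πt| ≥ 4a` (`0 < a ≤ 1/8`) ⟹ `∫₀¹ g ≤ 4aM`. -/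
theorem integral_layer_le {g : ℝ → ℝ} (hg : Continuous g) {a M : ℝ} (ha : 0 < a) (ha8 : a ≤ 8⁻¹)
    (hM : ∀ t, g t ≤ M) (hvan : ∀ t, 0 ≤ t → t ≤ 1 → 4 * a ≤ |Real.sin (2 * π * t)| → g t = 0) :
    ∫ t in (0 : ℝ)..1, g t ≤ 4 * a * M := by
  have hi : ∀ p q : ℝ, IntervalIntegrable g volume p q := fun p q => hg.intervalIntegrable p q
  have hpiece : ∀ p q : ℝ, p ≤ q → ∫ t in p..q, g t ≤ (q - p) * M := by
    intro p q hpq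
    have h := intervalIntegral.integral_mono_on hpq (hi p q) (intervalIntegrable_const (c := M))
      (fun t _ => hM t)
    simpa [intervalIntegral.integral_const, smul_eq_mul, mul_comm] using h
  have hzero1 : ∫ t in a..(2⁻¹ - a), g t = 0 := by
    rw [intervalIntegral.integral_congr (g := fun _ => (0 : ℝ)) ?_, intervalIntegral.integral_zero]
    intro t ht
    rw [uIcc_of_le (by linarith)] at ht
    exact hvan t (by linarith [ht.1]) (by linarith [ht.2]) (le_abs_sin_of_far (by linarith [ht.1]) (by linarith [ht.2])
      ht.1 (Or.inl ht.2) (by linarith [ht.2]))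
  have hzero2 : ∫ t in (2⁻¹ + a)..(1 - a), g t = 0 := by
    rw [intervalIntegral.integral_congr (g := fun _ => (0 : ℝ)) ?_, intervalIntegral.integral_zero]
    intro t ht
    rw [uIcc_of_le (by linarith)] at ht
    exact hvan t (by linarith [ht.1]) (by linarith [ht.2]) (le_abs_sin_of_far (by linarith [ht.1]) (by linarith [ht.2])
      (by linarith [ht.1]) (Or.inr ht.1) ht.2)
  have e : ∫ t in (0 : ℝ)..1, g t = (∫ t in (0 : ℝ)..a, g t) + (∫ t in a..(2⁻¹ - a), g t) +
      (∫ t in (2⁻¹ - a)..(2⁻¹ + a), g t) + (∫ t in (2⁻¹ + a)..(1 - a), g t) + ∫ t in (1 - a)..1, g t := by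
    rw [intervalIntegral.integral_add_adjacent_intervals (hi _ _) (hi _ _),
      intervalIntegral.integral_add_adjacent_intervals (hi _ _) (hi _ _),
      intervalIntegral.integral_add_adjacent_intervals (hi _ _) (hi _ _),
      intervalIntegral.integral_add_adjacent_intervals (hi _ _) (hi _ _)]
  rw [e, hzero1, hzero2]
  have h1 := hpiece 0 a ha.le
  have h2 := hpiece (2⁻¹ - a) (2⁻¹ + a) (by linarith)
  have h3 := hpiece (1 - a) 1 (by linarith)
  nlinarith


/-- `P_n` is smooth. -/
theorem contDiff_profile (n : ℝ) : ContDiff ℝ ∞ (fun t : ℝ =>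
    Real.smoothTransition (n * Real.sin (2 * π * t) + 2⁻¹) - Real.smoothTransition (2⁻¹ - n * Real.sin (2 * π * t))) :=
  contDiff_sgn.comp (contDiff_const.mul (Real.contDiff_sin.comp (contDiff_const.mul contDiff_id)))

/-- `P_n` is `1`-periodic. -/
theorem profile_add_one (n t : ℝ) :
    Real.smoothTransition (n * Real.sin (2 * π * (t + 1)) + 2⁻¹) - Real.smoothTransition (2⁻¹ - n * Real.sin (2 * π * (t + 1))) =
      Real.smoothTransition (n * Real.sin (2 * π * t) + 2⁻¹) - Real.smoothTransition (2⁻¹ - n * Real.sin (2 * π * t)) := by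
  rw [show 2 * π * (t + 1) = 2 * π * t + 2 * π by ring, Real.sin_add_two_pi]

/-- `P_n` is odd under the half-period shift. -/
theorem profile_add_half (n t : ℝ) :
    Real.smoothTransition (n * Real.sin (2 * π * (t + 2⁻¹)) + 2⁻¹) - Real.smoothTransition (2⁻¹ - n * Real.sin (2 * π * (t + 2⁻¹))) =
      -(Real.smoothTransition (n * Real.sin (2 * π * t) + 2⁻¹) - Real.smoothTransition (2⁻¹ - n * Real.sin (2 * π * t))) := by
  rw [show 2 * π * (t + 2⁻¹) = 2 * π * t + π by ring, Real.sin_add_pi, mul_neg, ← sgn_neg]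

/-- `|P_n| ≤ 1`. -/
theorem abs_profile_le (n t : ℝ) :
    |Real.smoothTransition (n * Real.sin (2 * π * t) + 2⁻¹) - Real.smoothTransition (2⁻¹ - n * Real.sin (2 * π * t))| ≤ 1 :=
  abs_sgn_le _

/-- Off the layer `P_n = ±1`, so `1 − P_n² = 0` there. -/
theorem one_sub_profile_sq_eq_zero {n t : ℝ} (h : 2⁻¹ ≤ |n * Real.sin (2 * π * t)|) :
    1 - (Real.smoothTransition (n * Real.sin (2 * π * t) + 2⁻¹) - Real.smoothTransition (2⁻¹ - n * Real.sin (2 * π * t))) ^ 2 = 0 := by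
  rcases le_abs'.1 h with h | h
  · rw [sgn_of_le_neg_half h]; norm_num
  · rw [sgn_of_half_le h]; norm_num

/-- `0 ≤ 1 − P_n² ≤ 1`. -/
theorem one_sub_profile_sq_mem (n t : ℝ) :
    0 ≤ 1 - (Real.smoothTransition (n * Real.sin (2 * π * t) + 2⁻¹) - Real.smoothTransition (2⁻¹ - n * Real.sin (2 * π * t))) ^ 2 ∧
    1 - (Real.smoothTransition (n * Real.sin (2 * π * t) + 2⁻¹) - Real.smoothTransition (2⁻¹ - n * Real.sin (2 * π * t))) ^ 2 ≤ 1 := by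
  have h := abs_profile_le n t
  rw [abs_le] at h
  constructor <;> nlinarith [sq_nonneg (Real.smoothTransition (n * Real.sin (2 * π * t) + 2⁻¹) - Real.smoothTransition (2⁻¹ - n * Real.sin (2 * π * t)))]

/-- The derivative of `P_n`. -/
theorem hasDerivAt_profile (n t : ℝ) :
    HasDerivAt (fun t : ℝ => Real.smoothTransition (n * Real.sin (2 * π * t) + 2⁻¹) - Real.smoothTransition (2⁻¹ - n * Real.sin (2 * π * t)))
      ((deriv Real.smoothTransition (n * Real.sin (2 * π * t) + 2⁻¹) + deriv Real.smoothTransition (2⁻¹ - n * Real.sin (2 * π * t))) *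
        (n * (2 * π * Real.cos (2 * π * t)))) t := by
  have hin : HasDerivAt (fun t : ℝ => n * Real.sin (2 * π * t)) (n * (2 * π * Real.cos (2 * π * t))) t := by
    have h := ((Real.hasDerivAt_sin (2 * π * t)).comp t ((hasDerivAt_id t).const_mul (2 * π))).const_mul n
    simpa [Function.comp_def, mul_comm, mul_left_comm, mul_assoc] using h
  exact (hasDerivAt_sgn (n * Real.sin (2 * π * t))).comp t hin

/-- Off the layer the derivative of `P_n` vanishes. -/
theorem deriv_profile_eq_zero {n t : ℝ} (h : 2⁻¹ ≤ |n * Real.sin (2 * π * t)|) :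
    (deriv Real.smoothTransition (n * Real.sin (2 * π * t) + 2⁻¹) + deriv Real.smoothTransition (2⁻¹ - n * Real.sin (2 * π * t))) *
      (n * (2 * π * Real.cos (2 * π * t))) = 0 := by
  rw [deriv_sgn_eq_zero h, zero_mul]

/-- A bound of the derivative of `P_n`: `|P_n'| ≤ 2π D |n|`. -/
theorem abs_deriv_profile_le {D : ℝ} (hD : ∀ y : ℝ, |deriv Real.smoothTransition (y + 2⁻¹) + deriv Real.smoothTransition (2⁻¹ - y)| ≤ D)
    (n t : ℝ) :
    |(deriv Real.smoothTransition (n * Real.sin (2 * π * t) + 2⁻¹) + deriv Real.smoothTransition (2⁻¹ - n * Real.sin (2 * π * t))) *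
      (n * (2 * π * Real.cos (2 * π * t)))| ≤ 2 * π * D * |n| := by
  have hD0 : 0 ≤ D := (abs_nonneg _).trans (hD 0)
  rw [abs_mul, abs_mul, abs_mul]
  have hc : |Real.cos (2 * π * t)| ≤ 1 := Real.abs_cos_le_one _
  have h2π : |2 * π| = 2 * π := abs_of_pos (by positivity)
  rw [h2π]
  calc |deriv Real.smoothTransition (n * Real.sin (2 * π * t) + 2⁻¹) + deriv Real.smoothTransition (2⁻¹ - n * Real.sin (2 * π * t))| *
        (|n| * (2 * π * |Real.cos (2 * π * t)|))
      ≤ D * (|n| * (2 * π * 1)) := by gcongr; exact hD _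
    _ = 2 * π * D * |n| := by ring


/-- `∫₀¹ (1 − P_n²) ≤ 1/(2n)` for `n ≥ 1`. -/
theorem integral_one_sub_profile_sq_le {n : ℝ} (hn : 1 ≤ n) :
    ∫ t in (0 : ℝ)..1, (1 - (Real.smoothTransition (n * Real.sin (2 * π * t) + 2⁻¹) -
      Real.smoothTransition (2⁻¹ - n * Real.sin (2 * π * t))) ^ 2) ≤ 1 / (2 * n) := by
  have hn0 : 0 < n := by linarith
  have ha : (0 : ℝ) < 1 / (8 * n) := by positivity
  have ha8 : 1 / (8 * n) ≤ 8⁻¹ := by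
    rw [div_le_iff₀ (by positivity)]; nlinarith
  have hcont : Continuous (fun t : ℝ => 1 - (Real.smoothTransition (n * Real.sin (2 * π * t) + 2⁻¹) -
      Real.smoothTransition (2⁻¹ - n * Real.sin (2 * π * t))) ^ 2) :=
    continuous_const.sub ((contDiff_profile n).continuous.pow 2)
  have h := integral_layer_le hcont ha ha8 (M := 1) (fun t => (one_sub_profile_sq_mem n t).2) ?_
  · calc _ ≤ 4 * (1 / (8 * n)) * 1 := h
      _ = 1 / (2 * n) := by field_simp; ring
  · intro t _ _ hfar
    refine one_sub_profile_sq_eq_zero ?_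
    rw [abs_mul, abs_of_pos hn0]
    have : 4 * (1 / (8 * n)) = 1 / (2 * n) := by field_simp; ring
    rw [this] at hfar
    calc (2⁻¹ : ℝ) = n * (1 / (2 * n)) := by field_simp
      _ ≤ n * |Real.sin (2 * π * t)| := by gcongr

/-- `∫₀¹ P_n'² ≤ 2π²D² n` for `n ≥ 1` (`|P_n'| ≤ 2πDn` on the layer, zero off it). -/
theorem integral_deriv_profile_sq_le {D : ℝ}
    (hD : ∀ y : ℝ, |deriv Real.smoothTransition (y + 2⁻¹) + deriv Real.smoothTransition (2⁻¹ - y)| ≤ D)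
    {n : ℝ} (hn : 1 ≤ n) :
    ∫ t in (0 : ℝ)..1, ((deriv Real.smoothTransition (n * Real.sin (2 * π * t) + 2⁻¹) +
        deriv Real.smoothTransition (2⁻¹ - n * Real.sin (2 * π * t))) * (n * (2 * π * Real.cos (2 * π * t)))) ^ 2 ≤
      2 * π ^ 2 * D ^ 2 * n := by
  have hn0 : 0 < n := by linarith
  have hD0 : 0 ≤ D := (abs_nonneg _).trans (hD 0)
  have ha : (0 : ℝ) < 1 / (8 * n) := by positivity
  have ha8 : 1 / (8 * n) ≤ 8⁻¹ := by
    rw [div_le_iff₀ (by positivity)]; nlinarith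
  have hcont : Continuous (fun t : ℝ => ((deriv Real.smoothTransition (n * Real.sin (2 * π * t) + 2⁻¹) +
        deriv Real.smoothTransition (2⁻¹ - n * Real.sin (2 * π * t))) * (n * (2 * π * Real.cos (2 * π * t)))) ^ 2) := by
    have h1 : Continuous (deriv Real.smoothTransition) :=
      (Real.smoothTransition.contDiff (n := 1)).continuous_deriv le_rfl
    have hs : Continuous (fun t : ℝ => n * Real.sin (2 * π * t)) := by fun_prop
    exact (((h1.comp (hs.add continuous_const)).add (h1.comp (continuous_const.sub hs))).mul (by fun_prop)).pow 2
  have hM : ∀ t, ((deriv Real.smoothTransition (n * Real.sin (2 * π * t) + 2⁻¹) +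
        deriv Real.smoothTransition (2⁻¹ - n * Real.sin (2 * π * t))) * (n * (2 * π * Real.cos (2 * π * t)))) ^ 2 ≤
      (2 * π * D * n) ^ 2 := by
    intro t
    have h := abs_deriv_profile_le hD n t
    rw [abs_of_pos hn0] at h
    have h0 : 0 ≤ 2 * π * D * n := by positivity
    calc _ = |(deriv Real.smoothTransition (n * Real.sin (2 * π * t) + 2⁻¹) +
          deriv Real.smoothTransition (2⁻¹ - n * Real.sin (2 * π * t))) * (n * (2 * π * Real.cos (2 * π * t)))| ^ 2 := (sq_abs _).symm
      _ ≤ (2 * π * D * n) ^ 2 := pow_le_pow_left₀ (abs_nonneg _) h 2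
  have h := integral_layer_le hcont ha ha8 hM ?_
  · calc _ ≤ 4 * (1 / (8 * n)) * (2 * π * D * n) ^ 2 := h
      _ = 2 * π ^ 2 * D ^ 2 * n := by field_simp; ring
  · intro t _ _ hfar
    rw [deriv_profile_eq_zero ?_]
    · ring
    rw [abs_mul, abs_of_pos hn0]
    have : 4 * (1 / (8 * n)) = 1 / (2 * n) := by field_simp; ring
    rw [this] at hfar
    calc (2⁻¹ : ℝ) = n * (1 / (2 * n)) := by field_simp
      _ ≤ n * |Real.sin (2 * π * t)| := by gcongr

/-- `P_n(0) = 0`. -/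
theorem profile_zero (n : ℝ) :
    Real.smoothTransition (n * Real.sin (2 * π * 0) + 2⁻¹) - Real.smoothTransition (2⁻¹ - n * Real.sin (2 * π * 0)) = 0 := by
  simp

/-- `P_n(1/(8n)) = 1` for `n ≥ 1` (Jordan: `n sin(π/(4n)) ≥ ½`). -/
theorem profile_eighth (n : ℝ) (hn : 1 ≤ n) :
    Real.smoothTransition (n * Real.sin (2 * π * (1 / (8 * n))) + 2⁻¹) -
      Real.smoothTransition (2⁻¹ - n * Real.sin (2 * π * (1 / (8 * n)))) = 1 := by
  have hn0 : 0 < n := by linarith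
  refine sgn_of_half_le ?_
  have h := four_mul_le_sin (t := 1 / (8 * n)) (by positivity) (by rw [div_le_iff₀ (by positivity)]; nlinarith)
  calc (2⁻¹ : ℝ) = n * (4 * (1 / (8 * n))) := by field_simp; ring
    _ ≤ n * Real.sin (2 * π * (1 / (8 * n))) := by gcongr

/-- `∫₀¹ P_n'² ≥ 8n` for `n ≥ 1` (FTC on `[0, 1/(8n)]` and `0 ≤ ∫(P_n' − 8n)²`). -/
theorem le_integral_deriv_profile_sq {n : ℝ} (hn : 1 ≤ n) :
    8 * n ≤ ∫ t in (0 : ℝ)..1, ((deriv Real.smoothTransition (n * Real.sin (2 * π * t) + 2⁻¹) +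
        deriv Real.smoothTransition (2⁻¹ - n * Real.sin (2 * π * t))) * (n * (2 * π * Real.cos (2 * π * t)))) ^ 2 := by
  have hn0 : 0 < n := by linarith
  set a : ℝ := 1 / (8 * n) with ha_def
  have ha : 0 < a := by positivity
  have ha1 : a ≤ 1 := by rw [ha_def, div_le_iff₀ (by positivity)]; nlinarith
  set P : ℝ → ℝ := fun t => Real.smoothTransition (n * Real.sin (2 * π * t) + 2⁻¹) -
      Real.smoothTransition (2⁻¹ - n * Real.sin (2 * π * t)) with hP
  set P' : ℝ → ℝ := fun t => (deriv Real.smoothTransition (n * Real.sin (2 * π * t) + 2⁻¹) +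
        deriv Real.smoothTransition (2⁻¹ - n * Real.sin (2 * π * t))) * (n * (2 * π * Real.cos (2 * π * t))) with hP'
  have hderiv : ∀ t, HasDerivAt P (P' t) t := fun t => hasDerivAt_profile n t
  have hcont' : Continuous P' := by
    have h1 : Continuous (deriv Real.smoothTransition) :=
      (Real.smoothTransition.contDiff (n := 1)).continuous_deriv le_rfl
    have hs : Continuous (fun t : ℝ => n * Real.sin (2 * π * t)) := by fun_prop
    exact ((h1.comp (hs.add continuous_const)).add (h1.comp (continuous_const.sub hs))).mul (by fun_prop)
  have hi : ∀ p q : ℝ, IntervalIntegrable P' volume p q := fun p q => hcont'.intervalIntegrable p q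
  have hi2 : ∀ p q : ℝ, IntervalIntegrable (fun t => P' t ^ 2) volume p q := fun p q => (hcont'.pow 2).intervalIntegrable p q
  have hFTC : ∫ t in (0 : ℝ)..a, P' t = 1 := by
    rw [intervalIntegral.integral_eq_sub_of_hasDerivAt (fun t _ => hderiv t) (hi 0 a)]
    have h0 : P 0 = 0 := profile_zero n
    have h1 : P a = 1 := profile_eighth n hn
    rw [h0, h1]; norm_num
  have hsq : 0 ≤ ∫ t in (0 : ℝ)..a, (P' t - 1 / a) ^ 2 :=
    intervalIntegral.integral_nonneg ha.le fun t _ => sq_nonneg _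
  have hexp : ∫ t in (0 : ℝ)..a, (P' t - 1 / a) ^ 2 =
      (∫ t in (0 : ℝ)..a, P' t ^ 2) - 2 / a * (∫ t in (0 : ℝ)..a, P' t) + a * (1 / a) ^ 2 := by
    have e : (fun t => (P' t - 1 / a) ^ 2) = fun t => P' t ^ 2 - (2 / a) * P' t + (1 / a) ^ 2 := by
      funext t; ring
    rw [e, intervalIntegral.integral_add ((hi2 0 a).sub ((hi 0 a).const_mul _)) (intervalIntegrable_const (c := (1 / a) ^ 2)),
      intervalIntegral.integral_sub (hi2 0 a) ((hi 0 a).const_mul _), intervalIntegral.integral_const_mul,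
      intervalIntegral.integral_const]
    simp
  rw [hexp, hFTC] at hsq
  have hkey : 1 / a ≤ ∫ t in (0 : ℝ)..a, P' t ^ 2 := by
    have e1 : a * (1 / a) ^ 2 = 1 / a := by field_simp
    have e2 : 2 / a * 1 = 2 * (1 / a) := by ring
    rw [e1, e2] at hsq
    linarith
  have hrest : 0 ≤ ∫ t in a..1, P' t ^ 2 := intervalIntegral.integral_nonneg ha1 fun t _ => sq_nonneg _
  have hsplit : ∫ t in (0 : ℝ)..1, P' t ^ 2 = (∫ t in (0 : ℝ)..a, P' t ^ 2) + ∫ t in a..1, P' t ^ 2 :=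
    (intervalIntegral.integral_add_adjacent_intervals (hi2 0 a) (hi2 a 1)).symm
  have hea : 1 / a = 8 * n := by rw [ha_def]; field_simp
  calc 8 * n = 1 / a := hea.symm
    _ ≤ ∫ t in (0 : ℝ)..a, P' t ^ 2 := hkey
    _ ≤ ∫ t in (0 : ℝ)..1, P' t ^ 2 := by rw [hsplit]; linarith


/-- **Registered tools stub `stub_sheetDodgerProfileTools`** (crux stmt-AnomalousDissipation-13038): the profile facts
consumed by the sheet-dodger field files (smoothness, symmetries, bounds, derivative, the three period integrals). -/
theorem stub_sheetDodgerProfileTools : (∀ n : ℝ, ContDiff ℝ ((⊤ : ℕ∞) : WithTop ℕ∞) (fun t : ℝ => Real.smoothTransition (n * Real.sin (2 * Real.pi * t) + 2⁻¹) - Real.smoothTransition (2⁻¹ - n * Real.sin (2 * Real.pi * t)))) ∧ (∀ n t : ℝ, Real.smoothTransition (n * Real.sin (2 * Real.pi * (t + 1)) + 2⁻¹) - Real.smoothTransition (2⁻¹ - n * Real.sin (2 * Real.pi * (t + 1))) = Real.smoothTransition (n * Real.sin (2 * Real.pi * t) + 2⁻¹) - Real.smoothTransition (2⁻¹ - n *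 Real.sin (2 * Real.pi * t))) ∧ (∀ n t : ℝ, Real.smoothTransition (n * Real.sin (2 * Real.pi * (t + 2⁻¹)) + 2⁻¹) - Real.smoothTransition (2⁻¹ - n * Real.sin (2 * Real.pi * (t + 2⁻¹))) = -(Real.smoothTransition (n * Real.sin (2 * Real.pi * t) + 2⁻¹) - Real.smoothTransition (2⁻¹ - n * Real.sin (2 * Real.pi * t)))) ∧ (∀ n t : ℝ, |Real.smoothTransition (n * Real.sin (2 * Real.pi * t) + 2⁻¹) - Real.smoothTransition (2⁻¹ - n * Real.sin (2 * Real.pi * t))| ≤ 1) ∧ (∀ n t : ℝ, 0 ≤ 1 - (Real.smoothTransition (n * Real.sin (2 * Real.pi * t) + 2⁻¹) - Real.smoothTransition (2⁻¹ - n * Real.sin (2 * Real.pi * t))) ^ 2 ∧ 1 - (Real.smoothTransition (n * Real.sin (2 * Real.pi * t) + 2⁻¹) - Real.smoothTransition (2⁻¹ - n * Real.sin (2 * Real.pi * t))) ^ 2 ≤ 1) ∧ (∀ n t : ℝ, HasDerivAt (fun t : ℝ => Real.smoothTransition (n * Real.sin (2 * Real.pi * t) + 2⁻¹) - Real.smoothTransition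 (2⁻¹ - n * Real.sin (2 * Real.pi * t))) ((deriv Real.smoothTransition (n * Real.sin (2 * Real.pi * t) + 2⁻¹) + deriv Real.smoothTransition (2⁻¹ - n * Real.sin (2 * Real.pi * t))) * (n * (2 * Real.pi * Real.cos (2 * Real.pi * t)))) t) ∧ (∀ n : ℝ, 1 ≤ n → intervalIntegral (fun t : ℝ => 1 - (Real.smoothTransition (n * Real.sin (2 * Real.pi * t) + 2⁻¹) - Real.smoothTransition (2⁻¹ - n * Real.sin (2 * Real.pi * t))) ^ 2) 0 1 MeasureTheory.volume ≤ 1 / (2 * n)) ∧ (∀ n : ℝ, 1 ≤ n → 8 * n ≤ intervalIntegral (fun t : ℝ => ((deriv Real.smoothTransition (n * Real.sin (2 * Real.pi * t) + 2⁻¹) + deriv Real.smoothTransition (2⁻¹ - n * Real.sin (2 * Real.pi * t))) * (n * (2 * Real.pi * Real.cos (2 * Real.pi * t)))) ^ 2) 0 1 MeasureTheory.volume) ∧ (∃ D : ℝ, 0 ≤ D ∧ (∀ n t : ℝ, |(deriv Real.smoothTransition (n * Real.sin (2 * Real.pi * t) + 2⁻¹) + deriv Real.smoothTransition (2⁻¹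 - n * Real.sin (2 * Real.pi * t))) * (n * (2 * Real.pi * Real.cos (2 * Real.pi * t)))| ≤ 2 * Real.pi * D * |n|) ∧ (∀ n : ℝ, 1 ≤ n → intervalIntegral (fun t : ℝ => ((deriv Real.smoothTransition (n * Real.sin (2 * Real.pi * t) + 2⁻¹) + deriv Real.smoothTransition (2⁻¹ - n * Real.sin (2 * Real.pi * t))) * (n * (2 * Real.pi * Real.cos (2 * Real.pi * t)))) ^ 2) 0 1 MeasureTheory.volume ≤ 2 * Real.pi ^ 2 * D ^ 2 * n)) := by
  obtain ⟨D, hD0, hD⟩ := exists_bound_deriv_sgn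
  refine ⟨contDiff_profile, profile_add_one, profile_add_half, abs_profile_le, one_sub_profile_sq_mem, hasDerivAt_profile,
    fun n hn => integral_one_sub_profile_sq_le hn, fun n hn => le_integral_deriv_profile_sq hn,
    D, hD0, abs_deriv_profile_le hD, fun n hn => integral_deriv_profile_sq_le hD hn⟩

end Summit.AnomalousDissipation.AnomalousDissipation.Theorems.SteadyStatesLoudBounded.SheetDodger

end
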